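/-
Port part B (cell rh-split, LINE L4 «σ», D′ of RULING #290): jen-neg g15 `JensenSignLawCount.lean` sha16 ab2c5cde8b4fedb8,
source ll.205–550 verbatim (+ one docstring on `xi_ne`); part A = `JensenSignLawCountA.lean`.
Nothing here bears on the truth of RH.
-/
import Summits.RiemannHypothesis.RiemannHypothesis.Theorems.Splittings.JensenSignLawCountA
import HarnessLib

/-!
# SIGN LAW = ROLLE-EXTREMALITY: conjunct B of X-4 as a root count (LINE L4 «σ») — cell `rh-split`, seat rh-split-jen-neg g15

HONEST LABEL: «SPLITTING SEARCH over kernel-typed RH-EQUIVALENCES; a splitting A ∧ B ⟹ RH is CONDITIONAL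
bookkeeping unless A and B are both proved; nothing here bears on the truth of RH.»  Sections 1–3 are RH-FREE
real-polynomial analysis (class level); the final `Dictionary` section only REWRITES the X-4 equivalence
`Splittings.JensenDerivativeLaguerre.rh_iff_rowsFromOne_and_rowZeroLaguerre` (an RH-equivalence stays an RH-equivalence).
Closes ledger item stmt-RiemannHypothesis-22168 (`EarlyAppointments.JensenSignLawIffRolleExtremal`, verbatim signature =
`item22168`). Source: desk file HOME=run/shared/lean/pub/rh-split/rh-split-jen-neg/g15/SigmaCount.lean.

**Theorem** (`signLaw_iff_rolleExtremal`, verbatim ledger signature `item22168`). For every nonzero real polynomial `p`: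

  (∀ x, p′(x) = 0 → p(x) ≠ 0 → p(x)·p″(x) < 0)  ⟺  card p.roots = card p′.roots + 1

(real roots with multiplicity). The left side is the strict Laguerre SIGN LAW at the critical points off the zero
set (conjunct B of the X-4 splitting `Splittings.JensenDerivativeLaguerre.rh_iff_rowsFromOne_and_rowZeroLaguerre`);
the right side says `p` attains Mathlib's Rolle bound `Polynomial.card_roots_le_derivative` with EQUALITY.

Proof. Write `Z` = distinct real roots of `p`, `C` = distinct real critical points, `C₁ = C \ Z`, `m = mult_{p′}`.
Always (p of positive degree): `card p.roots = Σ_Z m + #Z` and `card p′.roots = Σ_Z m + Σ_{C₁} m`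
(`derivative_rootMultiplicity_of_root`). (⇒) Under the sign law `m = 1` on `C₁` (`p″ ≠ 0` there) and the
interleaving-with-sentinels argument of the tree file `Splittings/JointPoly.lean` (its public lemmas `exists_root_Ioo`,
`exists_root_Ioi`, `exists_root_Iio` are reused verbatim; the one new input is `exists_root_of_odd_natDegree`, which
replaces the hypothesis `p′.Splits` of that file in the sentinel case) gives `#C₁ + 1 ≤ #Z`; with Mathlib's
`#Z ≤ #C₁ + 1` this is the identity. (⇐) From the identity, `#Z = Σ_{C₁} m + 1 ≤ #C₁ + 1`, so `m = 1` on `C₁`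
(every off-root critical point is a simple zero of `p′`, hence `p″ ≠ 0`) and `#Z = #C₁ + 1`; if the sign law failed at
`x₀ ∈ C₁` then `p(x₀)·p″(x₀) > 0`, so (after `p ↦ −p`) `x₀` is a strict local minimum with `p(x₀) > 0`
(`exists_ball_lt_of_deriv2_pos`), and the ENLARGED interleaving `Z ∪ {x₀}` against `C` (IVT + Rolle next to `x₀`)
gives `#Z + 1 ≤ #C₁` (`card_succ_le_of_localMin`) — contradiction. Degree 0: both sides fail. Pure Mathlib + the tree's
JointPoly lemmas; standard axioms; no named fact. NOTHING HERE BEARS ON THE TRUTH OF RH: this is a statement about all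
real polynomials; its use on the desk is to REWRITE conjunct B of X-4 as an integer (root-count) statement.
-/

open Polynomial Set Filter Topology

set_option linter.dupNamespace false

namespace Summit.RiemannHypothesis.RiemannHypothesis.Theorems.Splittings.JensenSignLawCount

open Summit.RiemannHypothesis.RiemannHypothesis.Theorems.Splittings.JointPoly

/-! ### The theorem -/

/-- **σ** (ledger item stmt-RiemannHypothesis-22168): for a nonzero real polynomial, the strict Laguerre sign law at
the critical points off the zero set is EQUIVALENT to Rolle-extremality `card p.roots = card p′.roots + 1`.
[folklore; Mathlib has the inequality `Polynomial.card_roots_le_derivative`] -/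
theorem signLaw_iff_rolleExtremal (p : ℝ[X]) (hp0 : p ≠ 0) : SignLaw p ↔ RolleExtremal p := by
  classical
  -- degree 0: a nonzero constant violates both sides
  by_cases hdeg0 : p.natDegree = 0
  · have hpC : p = C (p.coeff 0) := eq_C_of_natDegree_eq_zero hdeg0
    have ha : p.coeff 0 ≠ 0 := fun h ↦ hp0 (by rw [hpC, h, map_zero])
    constructor
    · intro h
      have h1 : (derivative p).eval 0 = 0 := by rw [hpC, derivative_C, eval_zero]
      have h2 : p.eval 0 ≠ 0 := by rw [hpC, eval_C]; exact ha
      have h3 := h 0 h1 h2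
      rw [hpC, derivative_C, derivative_zero, eval_zero, mul_zero] at h3
      exact absurd h3 (lt_irrefl 0)
    · intro h
      rw [RolleExtremal, hpC, derivative_C, roots_C, roots_zero] at h
      simp at h
  have hnat : 0 < p.natDegree := Nat.pos_of_ne_zero hdeg0
  have hdeg : 0 < p.degree := natDegree_pos_iff_degree_pos.1 hnat
  have hp'0 : derivative p ≠ 0 := fun h ↦ hdeg0 (derivative_eq_zero.1 h)
  -- notation
  set Z : Finset ℝ := p.roots.toFinset with hZ
  set C : Finset ℝ := (derivative p).roots.toFinset with hC
  set C₁ : Finset ℝ := C \ Z with hC₁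
  have memZ : ∀ x, x ∈ Z ↔ p.eval x = 0 := fun x ↦ by
    rw [hZ, Multiset.mem_toFinset, mem_roots hp0, IsRoot]
  have memC : ∀ x, x ∈ C ↔ (derivative p).eval x = 0 := fun x ↦ by
    rw [hC, Multiset.mem_toFinset, mem_roots hp'0, IsRoot]
  have memC₁ : ∀ x, x ∈ C₁ ↔ (derivative p).eval x = 0 ∧ p.eval x ≠ 0 := fun x ↦ by
    rw [hC₁, Finset.mem_sdiff, memC, memZ]
  -- the two count identities, valid for every real polynomial of positive degree
  have hI1 : p.roots.card = Z.sum (fun z ↦ (derivative p).rootMultiplicity z) + Z.card := by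
    have hN : p.roots.card = Z.sum (fun z ↦ (derivative p).rootMultiplicity z + 1) := by
      rw [hZ, ← Multiset.toFinset_sum_count_eq]
      refine Finset.sum_congr rfl fun z hz ↦ ?_
      rw [count_roots, derivative_rootMultiplicity_of_root ((memZ z).1 hz)]
      have : 0 < p.rootMultiplicity z := (rootMultiplicity_pos hp0).2 ((memZ z).1 hz)
      omega
    rw [hN, Finset.sum_add_distrib]; simp
  have hI2 : (derivative p).roots.card =
      Z.sum (fun z ↦ (derivative p).rootMultiplicity z) + C₁.sum (fun c ↦ (derivative p).rootMultiplicity c) := by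
    have hN' : (derivative p).roots.card = C.sum (fun c ↦ (derivative p).rootMultiplicity c) := by
      rw [hC, ← Multiset.toFinset_sum_count_eq]
      exact Finset.sum_congr rfl fun c _ ↦ by rw [count_roots]
    have hZC : (C ∩ Z).sum (fun z ↦ (derivative p).rootMultiplicity z) =
        Z.sum (fun z ↦ (derivative p).rootMultiplicity z) := by
      apply Finset.sum_subset Finset.inter_subset_right
      intro z hzZ hzCZ
      have hzC : z ∉ C := fun h ↦ hzCZ (Finset.mem_inter.2 ⟨h, hzZ⟩)
      rw [memC] at hzC
      exact rootMultiplicity_eq_zero hzC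
    rw [hN', ← hZC, hC₁]
    exact (Finset.sum_inter_add_sum_sdiff C Z _).symm
  -- Mathlib's Rolle count: #Z ≤ #C₁ + 1
  have hB : Z.card ≤ C₁.card + 1 := p.card_roots_toFinset_le_card_roots_derivative_sdiff_roots_succ
  -- every off-root critical point has positive multiplicity in p′
  have hmpos : ∀ c ∈ C₁, 1 ≤ (derivative p).rootMultiplicity c := fun c hc ↦
    (rootMultiplicity_pos hp'0).2 ((memC₁ c).1 hc).1
  constructor
  · -- (⇒): sign law ⟹ Rolle-extremal
    intro hsign
    -- (a) multiplicity one on C₁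
    have hmult1 : ∀ c ∈ C₁, (derivative p).rootMultiplicity c = 1 := by
      intro c hc
      obtain ⟨hc0, hpc⟩ := (memC₁ c).1 hc
      have hpos : 0 < (derivative p).rootMultiplicity c := hmpos c hc
      have h2 : (derivative (derivative p)).eval c ≠ 0 := by
        intro h; have := hsign c hc0 hpc; rw [h, mul_zero] at this; exact lt_irrefl _ this
      have h3 : (derivative (derivative p)).rootMultiplicity c = 0 :=
        rootMultiplicity_eq_zero (by simpa [IsRoot] using h2)
      have h4 := derivative_rootMultiplicity_of_root (p := derivative p) (t := c) hc0
      omega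
    -- (b) interleaving with sentinels ±M (as in the tree's JointPoly, without `p′.Splits`): #C₁ + 1 ≤ #Z
    obtain ⟨M, hM⟩ : ∃ M : ℝ, 0 < M ∧ (∀ x ∈ Z, |x| < M) ∧ (∀ x ∈ C, |x| < M) := by
      refine ⟨1 + (Z ∪ C).sum (fun x ↦ |x|), ?_, ?_, ?_⟩
      · have : 0 ≤ (Z ∪ C).sum (fun x ↦ |x|) := Finset.sum_nonneg fun _ _ ↦ abs_nonneg _
        linarith
      · intro x hx
        have : |x| ≤ (Z ∪ C).sum (fun x ↦ |x|) :=
          Finset.single_le_sum (fun _ _ ↦ abs_nonneg _) (Finset.mem_union_left _ hx)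
        linarith
      · intro x hx
        have : |x| ≤ (Z ∪ C).sum (fun x ↦ |x|) :=
          Finset.single_le_sum (fun _ _ ↦ abs_nonneg _) (Finset.mem_union_right _ hx)
        linarith
    obtain ⟨hM0, hMZ, hMC⟩ := hM
    have hC₁C : C₁ ⊆ C := Finset.sdiff_subset
    have hMnot : M ∉ C₁ := fun h ↦ by
      have := hMC M (hC₁C h); rw [abs_of_pos hM0] at this; exact lt_irrefl _ this
    have hnMnot : -M ∉ C₁ := fun h ↦ by
      have := hMC (-M) (hC₁C h); rw [abs_neg, abs_of_pos hM0] at this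
      exact lt_irrefl _ this
    have hMne : (-M) ≠ M := by linarith
    set S : Finset ℝ := insert (-M) (insert M C₁) with hS
    have hScard : S.card = C₁.card + 2 := by
      rw [hS, Finset.card_insert_of_notMem, Finset.card_insert_of_notMem hMnot]
      rw [Finset.mem_insert, not_or]; exact ⟨hMne, hnMnot⟩
    have key : S.card ≤ (Z \ S).card + 1 := by
      refine Finset.card_le_sdiff_of_interleaved fun x hx y hy hxy hgap ↦ ?_
      by_cases hmid : ∃ c ∈ C, p.eval c = 0 ∧ x < c ∧ c < y
      · obtain ⟨c, -, hc0, hxc, hcy⟩ := hmid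
        exact ⟨c, (memZ c).2 hc0, hxc, hcy⟩
      push Not at hmid
      have hnoC : ∀ z, x < z → z < y → (derivative p).eval z ≠ 0 := by
        intro z hxz hzy hz
        by_cases hpz : p.eval z = 0
        · exact absurd (hmid z ((memC z).2 hz) hpz hxz) (not_le.2 hzy)
        · exact hgap z (by rw [hS]; simp [(memC₁ z), hz, hpz]) ⟨hxz, hzy⟩
      have hxS := hx; have hyS := hy
      rw [hS, Finset.mem_insert, Finset.mem_insert] at hxS hyS
      have hxM : x ≠ M := by
        rintro rfl
        rcases hyS with rfl | rfl | hy1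
        · linarith
        · exact lt_irrefl _ hxy
        · have := hMC y (hC₁C hy1); rw [abs_lt] at this; linarith
      have hynM : y ≠ -M := by
        rintro rfl
        rcases hxS with rfl | rfl | hx1
        · exact lt_irrefl _ hxy
        · linarith
        · have := hMC x (hC₁C hx1); rw [abs_lt] at this; linarith
      rcases hxS with rfl | rfl | hx1
      · -- x = -M
        rcases hyS with rfl | rfl | hy1
        · exact absurd rfl hynM
        · -- y = M: then C₁ = ∅; a critical point is a root, and if there is none, p has odd degree
          by_cases hCne : C.Nonempty
          · obtain ⟨c, hc⟩ := hCne
            have hcM := hMC c hc; rw [abs_lt] at hcM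
            by_cases hpc : p.eval c = 0
            · exact ⟨c, (memZ c).2 hpc, hcM.1, hcM.2⟩
            · exact absurd ((memC c).1 hc) (hnoC c hcM.1 hcM.2)
          · have hodd : Odd p.natDegree := by
              rcases Nat.even_or_odd p.natDegree with ⟨k, hk⟩ | h
              · exfalso
                have hodd' : Odd (derivative p).natDegree := ⟨k - 1, by rw [natDegree_derivative]; omega⟩
                obtain ⟨c, hc⟩ := exists_root_of_odd_natDegree hodd'
                exact hCne ⟨c, (memC c).2 hc⟩
              · exact h
            obtain ⟨z, hz⟩ := exists_root_of_odd_natDegree hodd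
            have hzM := hMZ z ((memZ z).2 hz); rw [abs_lt] at hzM
            exact ⟨z, (memZ z).2 hz, hzM.1, hzM.2⟩
        · -- y ∈ C₁ is the first critical point off the zero set: left ray
          obtain ⟨hy0, hpy⟩ := (memC₁ y).1 hy1
          have hnoL : ∀ z, z < y → (derivative p).eval z ≠ 0 := by
            intro z hzy hz
            have hzC : z ∈ C := (memC z).2 hz
            have hzM := hMC z hzC; rw [abs_lt] at hzM
            exact hnoC z hzM.1 hzy hz
          obtain ⟨z, hzy, hz0⟩ := exists_root_Iio hdeg hy0 (hsign y hy0 hpy) hnoL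
          have hzM := hMZ z ((memZ z).2 hz0); rw [abs_lt] at hzM
          exact ⟨z, (memZ z).2 hz0, hzM.1, hzy⟩
      · exact absurd rfl hxM
      · -- x ∈ C₁
        obtain ⟨hx0, hpx⟩ := (memC₁ x).1 hx1
        rcases hyS with rfl | rfl | hy1
        · exact absurd rfl hynM
        · -- y = M: right ray
          have hnoR : ∀ z, x < z → (derivative p).eval z ≠ 0 := by
            intro z hxz hz
            have hzC : z ∈ C := (memC z).2 hz
            have hzM := hMC z hzC; rw [abs_lt] at hzM
            exact hnoC z hxz hzM.2 hz
          obtain ⟨z, hxz, hz0⟩ := exists_root_Ioi hdeg hx0 (hsign x hx0 hpx) hnoR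
          have hzM := hMZ z ((memZ z).2 hz0); rw [abs_lt] at hzM
          exact ⟨z, (memZ z).2 hz0, hxz, hzM.2⟩
        · -- both in C₁: bounded gap
          obtain ⟨hy0, hpy⟩ := (memC₁ y).1 hy1
          obtain ⟨z, hz, hz0⟩ := exists_root_Ioo hxy hx0 hy0 (hsign x hx0 hpx) (hsign y hy0 hpy)
            fun z hz ↦ hnoC z hz.1 hz.2
          exact ⟨z, (memZ z).2 hz0, hz.1, hz.2⟩
    have hZcard : C₁.card + 1 ≤ Z.card := by
      have := Finset.card_le_card (Finset.sdiff_subset (s := Z) (t := S))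
      omega
    -- (c) assemble
    have hsum1 : C₁.sum (fun c ↦ (derivative p).rootMultiplicity c) = C₁.card := by
      rw [Finset.card_eq_sum_ones]; exact Finset.sum_congr rfl hmult1
    show p.roots.card = (derivative p).roots.card + 1
    rw [hI1, hI2, hsum1]
    omega
  · -- (⇐): Rolle-extremal ⟹ sign law
    intro hR x₀ hx₀ hpx₀
    by_contra hnot
    push Not at hnot
    have hx₀C₁ : x₀ ∈ C₁ := (memC₁ x₀).2 ⟨hx₀, hpx₀⟩
    have hA : Z.card = C₁.sum (fun c ↦ (derivative p).rootMultiplicity c) + 1 := by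
      have h := hR
      rw [RolleExtremal, hI1, hI2] at h
      omega
    have hle1 : C₁.card ≤ C₁.sum (fun c ↦ (derivative p).rootMultiplicity c) := by
      rw [Finset.card_eq_sum_ones]; exact Finset.sum_le_sum hmpos
    -- all multiplicities on C₁ are 1; in particular at x₀
    have hm1 : (derivative p).rootMultiplicity x₀ = 1 := by
      by_contra hne
      have hlt : C₁.card < C₁.sum (fun c ↦ (derivative p).rootMultiplicity c) := by
        rw [Finset.card_eq_sum_ones]
        exact Finset.sum_lt_sum hmpos ⟨x₀, hx₀C₁, lt_of_le_of_ne (hmpos x₀ hx₀C₁) (Ne.symm hne)⟩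
      omega
    have hZeq : Z.card = C₁.card + 1 := by omega
    -- hence p″(x₀) ≠ 0, and the failed sign law reads p(x₀)·p″(x₀) > 0
    have h2ne : (derivative (derivative p)).eval x₀ ≠ 0 := by
      intro h2
      have : 1 < (derivative p).rootMultiplicity x₀ :=
        (one_lt_rootMultiplicity_iff_isRoot hp'0).2 ⟨hx₀, h2⟩
      omega
    have hprod : 0 < p.eval x₀ * (derivative (derivative p)).eval x₀ :=
      lt_of_le_of_ne hnot (mul_ne_zero hpx₀ h2ne).symm
    rcases lt_or_gt_of_ne hpx₀ with hneg | hpos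
    · -- p(x₀) < 0: pass to −p
      have h2neg : (derivative (derivative p)).eval x₀ < 0 := (neg_iff_neg_of_mul_pos hprod).1 hneg
      have key := card_succ_le_of_localMin (p := -p) (x₀ := x₀) (neg_ne_zero.2 hp0)
        (by rw [derivative_neg]; exact neg_ne_zero.2 hp'0) (by simp [hx₀]) (by simpa using hneg)
        (by simpa using h2neg)
      rw [derivative_neg, roots_neg, roots_neg, ← hZ, ← hC, ← hC₁] at key
      omega
    · have h2pos : 0 < (derivative (derivative p)).eval x₀ := (pos_iff_pos_of_mul_pos hprod).1 hpos
      have key := card_succ_le_of_localMin hp0 hp'0 hx₀ hpos h2pos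
      rw [← hZ, ← hC, ← hC₁] at key
      omega

/-- The ledger item, VERBATIM signature (stmt-RiemannHypothesis-22168 `EarlyAppointments.JensenSignLawIffRolleExtremal`). -/
theorem item22168 : ∀ p : Polynomial ℝ, p ≠ 0 → ((∀ x : ℝ, (Polynomial.derivative p).eval x = 0 →
    p.eval x ≠ 0 → p.eval x * (Polynomial.derivative (Polynomial.derivative p)).eval x < 0) ↔
    Multiset.card p.roots = Multiset.card (Polynomial.derivative p).roots + 1) :=
  fun p hp ↦ signLaw_iff_rolleExtremal p hp


/-! ### Corollaries: conjunct B of X-4 as a ROOT COUNT (hypothesis-free)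

`N(q) := nonrealRootCount q = natDegree q − card q.roots` (tree, `Literature.Analysis.Complex.HutchinsonMultiplier`),
`J^{d,n}_γ := jensenPoly γ d n`. -/

section Dictionary

open Literature.NumberTheory.LFunctions
open Literature.Analysis.Complex
open Summit.RiemannHypothesis.RiemannHypothesis.Theorems.Splittings

/-- Count form of σ: for `p` of positive degree the sign law holds iff `p` and `p′` carry the SAME number of
non-real zeros. -/
theorem signLaw_iff_nonrealRootCount_eq (p : ℝ[X]) (hp : 0 < p.natDegree) :
    SignLaw p ↔ nonrealRootCount p = nonrealRootCount (derivative p) := by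
  have hp0 : p ≠ 0 := by rintro rfl; simp at hp
  rw [signLaw_iff_rolleExtremal p hp0, RolleExtremal, nonrealRootCount, nonrealRootCount, natDegree_derivative]
  have h1 := card_roots' p
  have h2 := card_roots' (derivative p)
  have h3 := card_roots_le_derivative p
  rw [natDegree_derivative] at h2
  omega

/-- A row of a Jensen array is a nonzero polynomial as soon as `γ n ≠ 0` (its constant coefficient). -/
theorem jensenPoly_ne_zero_of {γ : ℕ → ℝ} {n : ℕ} (h : γ n ≠ 0) (d : ℕ) : jensenPoly γ d n ≠ 0 := by
  intro h0
  have h1 : (jensenPoly γ d n).coeff 0 = 0 := by rw [h0]; simp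
  rw [PolyaSchur.coeff_jensenPoly] at h1
  simp at h1
  exact h h1

/-- σ on the Jensen grid, CLASS LEVEL (every real `γ` with `γ n ≠ 0`): the sign law for `J^{d+1,n}_γ` holds iff
`card roots J^{d+1,n}_γ = card roots J^{d,n+1}_γ + 1`, via the shift rule `(J^{d+1,n})′ = (d+1)·J^{d,n+1}`. -/
theorem signLaw_jensenPoly_iff_card {γ : ℕ → ℝ} {n : ℕ} (hn : γ n ≠ 0) (d : ℕ) :
    SignLaw (jensenPoly γ (d + 1) n) ↔
      Multiset.card (jensenPoly γ (d + 1) n).roots = Multiset.card (jensenPoly γ d (n + 1)).roots + 1 := by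
  rw [signLaw_iff_rolleExtremal _ (jensenPoly_ne_zero_of hn (d + 1)), RolleExtremal,
    JensenLaguerreFlow.derivative_jensenPoly_succ, roots_C_mul]
  exact_mod_cast Nat.succ_ne_zero d

/-- … in `N`-form; here only the TOP coefficient `γ (n + (d+1)) ≠ 0` is needed (full degree `d + 1`):
`SignLaw (J^{d+1,n}_γ) ↔ N(J^{d+1,n}_γ) = N(J^{d,n+1}_γ)`. -/
theorem signLaw_jensenPoly_iff_nonrealRootCount {γ : ℕ → ℝ} {n d : ℕ} (htop : γ (n + (d + 1)) ≠ 0) :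
    SignLaw (jensenPoly γ (d + 1) n) ↔
      nonrealRootCount (jensenPoly γ (d + 1) n) = nonrealRootCount (jensenPoly γ d (n + 1)) := by
  have hdeg : (jensenPoly γ (d + 1) n).natDegree = d + 1 := natDegree_jensenPoly γ (d + 1) n htop
  rw [signLaw_iff_nonrealRootCount_eq _ (by rw [hdeg]; exact Nat.succ_pos d),
    JensenLaguerreFlow.derivative_jensenPoly_succ,
    JensenCountMonotonicity.nonrealRootCount_C_mul (by exact_mod_cast Nat.succ_ne_zero d)]

/-- NEG-LENS READING, class level: the sign law FAILS for `J^{d+1,n}_γ` iff STRICTLY MORE non-real zeros sit on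
`J^{d+1,n}_γ` than on `J^{d,n+1}_γ`. By T2 of the tree (`JensenCountMonotonicity.nonrealRootCount_jensenPoly_shift_le`,
Rolle) the count never drops along the anti-diagonal step `(d, n+1) → (d+1, n)`, so a failure of the sign law is
exactly a BIRTH of non-real zeros at that step — an integer certificate. -/
theorem not_signLaw_jensenPoly_iff_birth {γ : ℕ → ℝ} {n d : ℕ} (htop : γ (n + (d + 1)) ≠ 0) :
    ¬ SignLaw (jensenPoly γ (d + 1) n) ↔
      nonrealRootCount (jensenPoly γ d (n + 1)) < nonrealRootCount (jensenPoly γ (d + 1) n) := by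
  rw [signLaw_jensenPoly_iff_nonrealRootCount htop]
  have := JensenCountMonotonicity.nonrealRootCount_jensenPoly_shift_le γ d n
  omega

/-- `γ_n = xiTaylorCoeff n ≠ 0` (the ξ Taylor coefficients are positive). -/
theorem xi_ne (n : ℕ) : xiTaylorCoeff n ≠ 0 := (xiTaylorCoeff_pos_holds n).ne'

/-- **X-4 in count form, hypothesis-free** (g14's `LineSignLawCount.rh_iff_rowsFromOne_and_rowZeroCount` carried σ as
a hypothesis; σ is now proved): `RH ⟺ (rows n ≥ 1 hyperbolic) ∧ (∀ d ≥ 1, card roots J^{d+1,0}_ξ = card roots J^{d,1}_ξ + 1)`.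
An RH-equivalence (X-4 rewritten); nothing here bears on the truth of RH. -/
theorem rh_iff_rowsFromOne_and_rowZeroCount :
    _root_.RiemannHypothesis ↔
      (∀ d n : ℕ, 1 ≤ n → (jensenPoly xiTaylorCoeff d n).Splits) ∧
      (∀ d : ℕ, 1 ≤ d → Multiset.card (jensenPoly xiTaylorCoeff (d + 1) 0).roots =
        Multiset.card (jensenPoly xiTaylorCoeff d 1).roots + 1) := by
  rw [JensenDerivativeLaguerre.rh_iff_rowsFromOne_and_rowZeroLaguerre]
  refine and_congr Iff.rfl ⟨fun h d hd ↦ ?_, fun h d hd ↦ ?_⟩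
  · exact (signLaw_jensenPoly_iff_card (xi_ne 0) d).1 (h (d + 1) (by omega))
  · obtain ⟨e, rfl⟩ : ∃ e, d = e + 1 := ⟨d - 1, by omega⟩
    exact (signLaw_jensenPoly_iff_card (xi_ne 0) e).2 (h e (by omega))

/-- **X-4 in `N`-form, hypothesis-free**: `RH ⟺ (rows n ≥ 1 hyperbolic) ∧ (∀ d ≥ 1, N(J^{d+1,0}_ξ) = N(J^{d,1}_ξ))` —
conjunct B says exactly «no non-real zero is born on the step row 1 → row 0». An RH-equivalence; nothing here bears
on the truth of RH. -/
theorem rh_iff_rowsFromOne_and_noBirthOnRowZero :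
    _root_.RiemannHypothesis ↔
      (∀ d n : ℕ, 1 ≤ n → (jensenPoly xiTaylorCoeff d n).Splits) ∧
      (∀ d : ℕ, 1 ≤ d → nonrealRootCount (jensenPoly xiTaylorCoeff (d + 1) 0) =
        nonrealRootCount (jensenPoly xiTaylorCoeff d 1)) := by
  rw [JensenDerivativeLaguerre.rh_iff_rowsFromOne_and_rowZeroLaguerre]
  refine and_congr Iff.rfl ⟨fun h d hd ↦ ?_, fun h d hd ↦ ?_⟩
  · exact (signLaw_jensenPoly_iff_nonrealRootCount (xi_ne _)).1 (h (d + 1) (by omega))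
  · obtain ⟨e, rfl⟩ : ∃ e, d = e + 1 := ⟨d - 1, by omega⟩
    exact (signLaw_jensenPoly_iff_nonrealRootCount (xi_ne _)).2 (h e (by omega))

/-- **NEG-LENS form of X-4** (hypothesis-free): `RH` fails iff some row `n ≥ 1` of the ξ-array is non-hyperbolic at some
degree, or a non-real pair is BORN on row 0: `∃ d ≥ 1, N(J^{d,1}_ξ) < N(J^{d+1,0}_ξ)`. The second disjunct is an
integer certificate (two root counts). An RH-equivalence restated; nothing here bears on the truth of RH. -/
theorem not_rh_iff_rowFailure_or_birthOnRowZero :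
    ¬ _root_.RiemannHypothesis ↔
      (∃ d n : ℕ, 1 ≤ n ∧ ¬ (jensenPoly xiTaylorCoeff d n).Splits) ∨
      (∃ d : ℕ, 1 ≤ d ∧ nonrealRootCount (jensenPoly xiTaylorCoeff d 1) <
        nonrealRootCount (jensenPoly xiTaylorCoeff (d + 1) 0)) := by
  rw [rh_iff_rowsFromOne_and_noBirthOnRowZero, not_and_or]
  refine or_congr ⟨fun h ↦ ?_, fun h ↦ ?_⟩ ⟨fun h ↦ ?_, fun h ↦ ?_⟩
  · push Not at h; exact h
  · push Not; exact h
  · push Not at h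
    obtain ⟨d, hd, hne⟩ := h
    exact ⟨d, hd, lt_of_le_of_ne
      (JensenCountMonotonicity.nonrealRootCount_jensenPoly_shift_le xiTaylorCoeff d 0) (Ne.symm hne)⟩
  · obtain ⟨d, hd, hlt⟩ := h
    push Not
    exact ⟨d, hd, hlt.ne'⟩

end Dictionary

end Summit.RiemannHypothesis.RiemannHypothesis.Theorems.Splittings.JensenSignLawCount
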